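import Mathlib
import HarnessLib
import Summits.AtomisticToContinuum.FouriersLaw.Theses.JunctionLocality
import Literature.MathematicalPhysics.KineticTheory.LangevinChainGibbs
import Summits.AtomisticToContinuum.FouriersLaw.Theorems.JunctionLocalitySuperadditiveResistanceKuboFrame
import Summits.AtomisticToContinuum.FouriersLaw.Theorems.JunctionLocalitySuperadditiveResistanceKuboDefinite

/-!
# The Kubo frame from the four terminal forward fields (structural half of stub `stub_kuboFrame`,
line `thermalise-then-cut-probe-insertion`, crux stmt-AtomisticToContinuum-11748, skeleton v3)

Helper file (`--supports` stmt-AtomisticToContinuum-11748). The registered `stub_kuboFrame` asks for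
`∃ g gb₁ gb₄, KuboFrame (pinnedChain ω₂ lam β γ) T N M g gb₁ gb₄` (`Theorems/…KuboFrame.lean`). Proved here,
unconditionally: given four terminal forward fields `gb a` (`a : Fin 4`, sites `termSite N M = (0, N−1, N, N+M−1)`;
classical `C² ∩ L²(μ_T)` solutions of `L_dev (gb a) = −(p²_{s_a} − T)`), the off-diagonal KUBO MATRIX
`g a b = (γ²/T²)⟨gb a, p²_{s_b} − T⟩_{μ_T}` (`a ≠ b`; diagonal `0`, invisible to the entropy form) satisfies every
clause of `KuboFrame`: symmetry = ONSAGER RECIPROCITY (`Kubo.onsager_symmetry`; the sources `p² − T` are even in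
the momenta); the self-row clauses = the SUM RULE `Σ_b ⟨gb a, p²_{s_b} − T⟩ = T²/γ` (reciprocity against the pair
`(H, γ Σ_b (p²_{s_b} − T))`: `X_H H = 0`, `S_B H = −Σ_b (p²_{s_b} − T)`, `⟨p² − T, H⟩_{μ_T} = T²`); non-negativity
of the entropy form `Σ_{a,b} g_ab (θ_a − θ_b)² = (2γ²/T²)(T²|θ|²/γ − ⟨g_θ, k_θ⟩)` = the landed completion of the
square `Kubo.integral_comb_kinetic_le`. Results: `kuboFrame_kuboMatrix` (explicit matrix; the probe fields need
no `S_K gb ∈ L²` clause), `kuboFrame_of_forwardFields` (registered: `(∀ a, IsForwardField … (termSite N M a) (gb a))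
→ ∃ g, KuboFrame …`), `stub_kuboFrame_of_forwardFields` (the stub follows from the EXISTENCE of the four fields —
quantitative ergodicity of the four-thermostat network at equilibrium, Cuneo–Eckmann–Hairer–Rey-Bellet 2018
Thm 2.13 (3), plus `S_K gb ∈ L²(μ_T)` for the end fields; not in the tree). All analysis is the sibling line's
landed toolkit `Theorems/…Kubo{Cutoff,…,Definite}.lean`; this file is bookkeeping between the two vocabularies
(`deviceGenerator = X_H + γ S_B`, `deviceWeight = termWeight`). No definitions. References: Eckmann–Pillet–Rey-Bellet,
CMP 201 (1999) §3 (reciprocity at equilibrium); folklore.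
-/

noncomputable section

open MeasureTheory Filter Topology ProbabilityTheory
open scoped ContDiff NNReal
open Literature.MathematicalPhysics.KineticTheory.HeatConduction

namespace Summit.AtomisticToContinuum.FouriersLaw.Cruxes.SuperadditiveResistance.ThermaliseThenCutProbeInsertion

open Summit.AtomisticToContinuum.FouriersLaw.Theorems.SuperadditiveResistance
open Summit.AtomisticToContinuum.FouriersLaw.Theorems.SuperadditiveResistance.Kubo
  (rev rev_apply comb comb_apply termWeight termWeight_nonneg sum_termWeight_mul onsager_symmetry
    integral_comb_kinetic_le integral_comb_mul_comb memLp_kinetic memLp_hamiltonian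
    integral_kinetic_mul_hamiltonian_mul_gibbsDensity integrable_mul_mul_gibbsDensity partialP_snd_self)
open Summit.AtomisticToContinuum.FouriersLaw.Theorems.SuperadditiveResistance.DeviceLiouville
  (liouvilleOp bathOp deviceWeight deviceGenerator_eq kin_eq_sq)

/-! ## The Hamiltonian as a `σ`-pair -/

section HamiltonianPair

/-- The kinetic observables `p_i² − T` are even in the momenta. -/
theorem rev_kinetic (L : ℕ) (T : ℝ) (i : Fin L) :
    rev (fun y : PhaseSpace L => y.2 i ^ 2 - T) = fun y => y.2 i ^ 2 - T := by
  funext y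
  simp [rev_apply]

/-- `S_B H = −Σ_i B_i (p_i² − T)` for thermostats at temperature `T`. -/
theorem bathOp_hamiltonian (P : OscillatorChain) (L : ℕ) (B : Fin L → ℝ) (T : ℝ) (x : PhaseSpace L) :
    bathOp L B T (P.hamiltonian L) x = -∑ i, B i * (x.2 i ^ 2 - T) := by
  have h1 : ∀ i : Fin L, partialP i (P.hamiltonian L) = fun y : PhaseSpace L => y.2 i :=
    fun i => funext fun y => P.partialP_hamiltonian L y i
  simp only [DeviceLiouville.bathOp, h1, partialP_snd_self]
  rw [← Finset.sum_neg_distrib]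
  exact Finset.sum_congr rfl fun i _ => by ring

/-- `H` is a `σ`-pair of `σ X_H + c S_B` with (even) source `c Σ_i B_i (p_i² − T)` (`X_H H = 0`). -/
theorem hamiltonian_pair (P : OscillatorChain) (L : ℕ) (B : Fin L → ℝ) (T σ c : ℝ) (x : PhaseSpace L) :
    σ * liouvilleOp P L (P.hamiltonian L) x + c * bathOp L B T (P.hamiltonian L) x =
      -(c * ∑ i, B i * (x.2 i ^ 2 - T)) := by
  have hX : liouvilleOp P L (P.hamiltonian L) x = 0 := by
    simp only [DeviceLiouville.liouvilleOp, P.partialP_hamiltonian]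
    exact Finset.sum_eq_zero fun i _ => by ring
  rw [hX, bathOp_hamiltonian]
  ring

end HamiltonianPair

/-! ## Kubo pairings of a terminal frame (Lebesgue form, then `μ_T` form) -/

section TerminalFrame

variable {ω₂ lam β γ : ℝ} {L m : ℕ}

variable (hω : 0 < ω₂) (hl : 0 ≤ lam) (hβ : 0 ≤ β) {T : ℝ} (hT : 0 < T) (s : Fin m → Fin L) (σ : ℝ)
  {c : ℝ} (hc : 0 < c) {g : Fin m → PhaseSpace L → ℝ}
  (hg : ∀ a, ContDiff ℝ 2 (g a)) (hgL : ∀ a, MemLp (g a) 2 ((pinnedChain ω₂ lam β γ).gibbsMeasure L T))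
  (hpde : ∀ a x, σ * liouvilleOp (pinnedChain ω₂ lam β γ) L (g a) x + c * bathOp L (termWeight s) T (g a) x =
    -(x.2 (s a) ^ 2 - T))
include hω hl hβ hT hc hg hgL hpde

/-- **Onsager reciprocity of the terminal Kubo pairings**: `∫ gb_a (p²_{s_b} − T) ρ = ∫ gb_b (p²_{s_a} − T) ρ`. -/
theorem kuboPairing_symm (a b : Fin m) :
    ∫ x, g a x * (x.2 (s b) ^ 2 - T) * (pinnedChain ω₂ lam β γ).gibbsDensity L T x =
      ∫ x, g b x * (x.2 (s a) ^ 2 - T) * (pinnedChain ω₂ lam β γ).gibbsDensity L T x :=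
  onsager_symmetry hω hl hβ L hT (termWeight s) (termWeight_nonneg s) σ hc (hg b) (hg a) (hgL b)
    (hgL a) (memLp_kinetic hω hl hβ L hT (s b)) (memLp_kinetic hω hl hβ L hT (s a))
    (rev_kinetic L T (s b)) (rev_kinetic L T (s a)) (hpde b) (hpde a)

/-- **Sum rule**: `c Σ_b ∫ gb_a (p²_{s_b} − T) ρ = T² ∫ ρ` (reciprocity against the pair
`(H, c Σ_b (p²_{s_b} − T))` and the Gibbs covariance `∫ (p² − T) H ρ = T² ∫ ρ`). -/
theorem kuboPairing_rowsum (a : Fin m) :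
    c * ∑ b, ∫ x, g a x * (x.2 (s b) ^ 2 - T) * (pinnedChain ω₂ lam β γ).gibbsDensity L T x =
      T ^ 2 * ∫ x, (pinnedChain ω₂ lam β γ).gibbsDensity L T x := by
  have hH2 : ContDiff ℝ 2 ((pinnedChain ω₂ lam β γ).hamiltonian L) :=
    (pinnedChain ω₂ lam β γ).contDiff_hamiltonian (pinnedChain_contDiff_U ω₂ lam β γ)
      (pinnedChain_contDiff_V ω₂ lam β γ) L
  have hHL : MemLp ((pinnedChain ω₂ lam β γ).hamiltonian L) 2 ((pinnedChain ω₂ lam β γ).gibbsMeasure L T) :=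
    memLp_hamiltonian hω hl hβ L hT
  set kH : PhaseSpace L → ℝ := fun x => c * ∑ b, (x.2 (s b) ^ 2 - T) with hkH
  have hkHL : MemLp kH 2 ((pinnedChain ω₂ lam β γ).gibbsMeasure L T) :=
    (memLp_finsetSum _ fun b _ => memLp_kinetic hω hl hβ L hT (s b)).const_mul c
  have hkH_even : rev kH = kH := by
    funext x
    simp [hkH, rev_apply]
  have hpH : ∀ x, σ * liouvilleOp (pinnedChain ω₂ lam β γ) L ((pinnedChain ω₂ lam β γ).hamiltonian L) x +
      c * bathOp L (termWeight s) T ((pinnedChain ω₂ lam β γ).hamiltonian L) x = -kH x := by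
    intro x
    rw [hamiltonian_pair, sum_termWeight_mul s (fun i => x.2 i ^ 2 - T)]
  have hons := onsager_symmetry hω hl hβ L hT (termWeight s) (termWeight_nonneg s) σ hc (hg a) hH2
    (hgL a) hHL (memLp_kinetic hω hl hβ L hT (s a)) hkHL (rev_kinetic L T (s a)) hkH_even (hpde a) hpH
  -- hons : ∫ H (p²_{s_a} − T) ρ = ∫ g a · kH ρ
  have hlhs : ∫ x, (pinnedChain ω₂ lam β γ).hamiltonian L x * (x.2 (s a) ^ 2 - T) *
      (pinnedChain ω₂ lam β γ).gibbsDensity L T x =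
      T ^ 2 * ∫ x, (pinnedChain ω₂ lam β γ).gibbsDensity L T x := by
    rw [← integral_kinetic_mul_hamiltonian_mul_gibbsDensity hω hl hβ L hT (s a)]
    exact integral_congr_ae (ae_of_all _ fun x => by ring)
  have hI : ∀ b, Integrable fun x => g a x * (x.2 (s b) ^ 2 - T) * (pinnedChain ω₂ lam β γ).gibbsDensity L T x :=
    fun b => integrable_mul_mul_gibbsDensity hω hl hβ γ L hT (hgL a) (memLp_kinetic hω hl hβ L hT (s b))
  have hrhs : ∫ x, g a x * kH x * (pinnedChain ω₂ lam β γ).gibbsDensity L T x =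
      c * ∑ b, ∫ x, g a x * (x.2 (s b) ^ 2 - T) * (pinnedChain ω₂ lam β γ).gibbsDensity L T x := by
    have hpt : (fun x => g a x * kH x * (pinnedChain ω₂ lam β γ).gibbsDensity L T x) =
        fun x => ∑ b, c * (g a x * (x.2 (s b) ^ 2 - T) * (pinnedChain ω₂ lam β γ).gibbsDensity L T x) := by
      funext x
      simp only [hkH, Finset.mul_sum, Finset.sum_mul]
      exact Finset.sum_congr rfl fun b _ => by ring
    rw [hpt, integral_finsetSum _ fun b _ => (hI b).const_mul c, Finset.mul_sum]
    exact Finset.sum_congr rfl fun b _ => integral_const_mul _ _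
  rw [← hrhs, ← hons, hlhs]

/-- **Non-negative entropy production** (the landed completion of the square, bilinearly expanded):
`Σ_{a,b} θ_a θ_b ∫ gb_a (p²_{s_b} − T) ρ ≤ (T²/c) |θ|² ∫ ρ` (distinct terminal sites). -/
theorem kuboPairing_psd (hs : Function.Injective s) (θ : Fin m → ℝ) :
    ∑ a, ∑ b, θ a * θ b * ∫ x, g a x * (x.2 (s b) ^ 2 - T) * (pinnedChain ω₂ lam β γ).gibbsDensity L T x ≤
      T ^ 2 / c * (∑ a, θ a ^ 2) * ∫ x, (pinnedChain ω₂ lam β γ).gibbsDensity L T x := by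
  have h := integral_comb_kinetic_le hω hl hβ L hT s hs σ hc hg hgL hpde θ
  rw [integral_comb_mul_comb hω hl hβ L hT θ θ hgL (fun b => memLp_kinetic hω hl hβ L hT (s b))] at h
  exact h

/-- Onsager reciprocity, `μ_T` form. -/
theorem kuboPairing_symm_measure (a b : Fin m) :
    ∫ x, g a x * (x.2 (s b) ^ 2 - T) ∂((pinnedChain ω₂ lam β γ).gibbsMeasure L T) =
      ∫ x, g b x * (x.2 (s a) ^ 2 - T) ∂((pinnedChain ω₂ lam β γ).gibbsMeasure L T) := by
  rw [(pinnedChain ω₂ lam β γ).integral_gibbsMeasure, (pinnedChain ω₂ lam β γ).integral_gibbsMeasure,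
    kuboPairing_symm hω hl hβ hT s σ hc hg hgL hpde a b]

/-- Sum rule, `μ_T` form: `Σ_b ⟨gb_a, p²_{s_b} − T⟩_{μ_T} = T²/c`. -/
theorem kuboPairing_rowsum_measure (a : Fin m) :
    ∑ b, ∫ x, g a x * (x.2 (s b) ^ 2 - T) ∂((pinnedChain ω₂ lam β γ).gibbsMeasure L T) = T ^ 2 / c := by
  have hZ : 0 < ∫ x, (pinnedChain ω₂ lam β γ).gibbsDensity L T x :=
    integral_exp_pos (pinnedChain_integrable_gibbsDensity hω hl hβ γ L hT)
  have h := kuboPairing_rowsum hω hl hβ hT s σ hc hg hgL hpde a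
  simp only [(pinnedChain ω₂ lam β γ).integral_gibbsMeasure]
  rw [← Finset.mul_sum, inv_mul_eq_div, div_eq_div_iff hZ.ne' hc.ne']
  linarith

/-- Non-negative entropy production, `μ_T` form: `Σ_{a,b} θ_a θ_b ⟨gb_a, p²_{s_b} − T⟩_{μ_T} ≤ (T²/c)|θ|²`. -/
theorem kuboPairing_psd_measure (hs : Function.Injective s) (θ : Fin m → ℝ) :
    ∑ a, ∑ b, θ a * θ b * ∫ x, g a x * (x.2 (s b) ^ 2 - T) ∂((pinnedChain ω₂ lam β γ).gibbsMeasure L T) ≤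
      T ^ 2 / c * ∑ a, θ a ^ 2 := by
  have hZ : 0 < ∫ x, (pinnedChain ω₂ lam β γ).gibbsDensity L T x :=
    integral_exp_pos (pinnedChain_integrable_gibbsDensity hω hl hβ γ L hT)
  have h := kuboPairing_psd hω hl hβ hT s σ hc hg hgL hpde hs θ
  simp only [(pinnedChain ω₂ lam β γ).integral_gibbsMeasure]
  have e : ∑ a, ∑ b, θ a * θ b * ((∫ x, (pinnedChain ω₂ lam β γ).gibbsDensity L T x)⁻¹ *
      ∫ x, g a x * (x.2 (s b) ^ 2 - T) * (pinnedChain ω₂ lam β γ).gibbsDensity L T x) =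
      (∫ x, (pinnedChain ω₂ lam β γ).gibbsDensity L T x)⁻¹ *
        ∑ a, ∑ b, θ a * θ b *
          ∫ x, g a x * (x.2 (s b) ^ 2 - T) * (pinnedChain ω₂ lam β γ).gibbsDensity L T x := by
    rw [Finset.mul_sum]
    refine Finset.sum_congr rfl fun a _ => ?_
    rw [Finset.mul_sum]
    exact Finset.sum_congr rfl fun b _ => by ring
  rw [e, inv_mul_le_iff₀ hZ]
  calc _ ≤ _ := h
    _ = _ := by ring

end TerminalFrame

/-! ## The entropy form of an off-diagonal Kubo matrix (pure algebra on `Fin 4`) -/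

section Algebra

/-- For a symmetric `J` with constant row sums `R`, the entropy form of the matrix with off-diagonal
entries `κ J_ab` is `2κ (R|θ|² − θᵀJθ)` (whatever the diagonal). -/
theorem dirichletForm_eq_of_rowsum {g J : Fin 4 → Fin 4 → ℝ} {κ R : ℝ}
    (hoff : ∀ a b, a ≠ b → g a b = κ * J a b) (hsym : ∀ a b, J a b = J b a)
    (hrow : ∀ a, ∑ b, J a b = R) (θ : Fin 4 → ℝ) :
    dirichletForm g θ = 2 * κ * (R * ∑ a, θ a ^ 2 - ∑ a, ∑ b, θ a * θ b * J a b) := by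
  have e1 : dirichletForm g θ = ∑ a, ∑ b, κ * J a b * (θ a - θ b) ^ 2 := by
    unfold dirichletForm
    refine Finset.sum_congr rfl fun a _ => Finset.sum_congr rfl fun b _ => ?_
    by_cases hab : a = b
    · subst hab; simp
    · rw [hoff a b hab]
  have hcol : ∀ b, ∑ a, J a b = R := fun b => by
    rw [show ∑ a, J a b = ∑ a, J b a from Finset.sum_congr rfl fun a _ => hsym a b]
    exact hrow b
  have hr0 := hrow 0; have hr1 := hrow 1; have hr2 := hrow 2; have hr3 := hrow 3
  have hc0 := hcol 0; have hc1 := hcol 1; have hc2 := hcol 2; have hc3 := hcol 3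
  simp only [Fin.sum_univ_four] at hr0 hr1 hr2 hr3 hc0 hc1 hc2 hc3 ⊢
  rw [e1]; simp only [Fin.sum_univ_four]
  linear_combination κ * θ 0 ^ 2 * hr0 + κ * θ 1 ^ 2 * hr1 + κ * θ 2 ^ 2 * hr2 + κ * θ 3 ^ 2 * hr3 +
    κ * θ 0 ^ 2 * hc0 + κ * θ 1 ^ 2 * hc1 + κ * θ 2 ^ 2 * hc2 + κ * θ 3 ^ 2 * hc3

/-- Hence the entropy form is non-negative when `κ ≥ 0` and `θᵀJθ ≤ R|θ|²`. -/
theorem dirichletForm_nonneg_of_rowsum {g J : Fin 4 → Fin 4 → ℝ} {κ R : ℝ} (hκ : 0 ≤ κ)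
    (hoff : ∀ a b, a ≠ b → g a b = κ * J a b) (hsym : ∀ a b, J a b = J b a)
    (hrow : ∀ a, ∑ b, J a b = R) (hpsd : ∀ θ : Fin 4 → ℝ, ∑ a, ∑ b, θ a * θ b * J a b ≤ R * ∑ a, θ a ^ 2)
    (θ : Fin 4 → ℝ) : 0 ≤ dirichletForm g θ := by
  rw [dirichletForm_eq_of_rowsum hoff hsym hrow θ]
  exact mul_nonneg (mul_nonneg zero_le_two hκ) (sub_nonneg.2 (hpsd θ))

end Algebra

/-! ## The device: terminal sites, weights, and the Kubo frame -/

section Device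

variable {N M : ℕ}

/-- The four terminal sites are distinct (`N, M ≥ 2`). -/
theorem termSite_injective (hN : 2 ≤ N) (hM : 2 ≤ M) :
    Function.Injective (termSite N M) := by
  intro a b h
  fin_cases a <;> fin_cases b <;> simp [termSite] at h ⊢ <;> omega

/-- The device's thermostat weights are the terminal weights of the four terminal sites. -/
theorem deviceWeight_eq_termWeight (s : Fin 4 → Fin (N + M))
    (hs : ∀ a, (s a).val = termSite N M a) : deviceWeight N M = termWeight s := by
  funext i
  have h0 : (s 0 = i) ↔ i.val = 0 := by rw [Fin.ext_iff, hs 0]; simp [termSite, eq_comm]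
  have h1 : (s 1 = i) ↔ i.val = N - 1 := by rw [Fin.ext_iff, hs 1]; simp [termSite, eq_comm]
  have h2 : (s 2 = i) ↔ i.val = N := by rw [Fin.ext_iff, hs 2]; simp [termSite, eq_comm]
  have h3 : (s 3 = i) ↔ i.val = N + M - 1 := by rw [Fin.ext_iff, hs 3]; simp [termSite, eq_comm]
  simp only [DeviceLiouville.deviceWeight, OscillatorChain.bathWeight, Kubo.termWeight, Fin.sum_univ_four,
    h0, h1, h2, h3]
  split_ifs <;> norm_num

end Device

section Main

variable {ω₂ lam β γ : ℝ}

/-- **The Kubo frame from four terminal forward fields (explicit matrix).** For `pinnedChain ω₂ lam β γ`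
(all `> 0`), `T > 0`, `N, M ≥ 2` and four classical terminal forward fields `gb a ∈ C² ∩ L²(μ_T)`,
`L_dev (gb a) = −(p²_{s_a} − T)` pointwise (`s = termSite N M`), the END fields moreover mean-zero with
`S_K gb ∈ L²(μ_T)` (i.e. `IsForwardField` at sites `0` and `N+M−1`), the off-diagonal Kubo matrix
`g a b = (γ²/T²)⟨gb a, p²_{s_b} − T⟩_{μ_T}` (`a ≠ b`; diagonal `0`) is a `KuboFrame` for `gb 0, gb 3`. -/
theorem kuboFrame_kuboMatrix (hω : 0 < ω₂) (hl : 0 < lam) (hβ : 0 < β) (hγ : 0 < γ) {T : ℝ}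
    (hT : 0 < T) {N M : ℕ} (hN : 2 ≤ N) (hM : 2 ≤ M) (gb : Fin 4 → PhaseSpace (N + M) → ℝ)
    (hC : ∀ a, ContDiff ℝ 2 (gb a))
    (hL2 : ∀ a, MemLp (gb a) 2 ((pinnedChain ω₂ lam β γ).gibbsMeasure (N + M) T))
    (hpde : ∀ a x, deviceGenerator (pinnedChain ω₂ lam β γ) N M (fun _ => T) (gb a) x =
      -(kin (N + M) (termSite N M a) x - T))
    (h0 : IsForwardField (pinnedChain ω₂ lam β γ) T N M 0 (gb 0))
    (h3 : IsForwardField (pinnedChain ω₂ lam β γ) T N M (N + M - 1) (gb 3)) :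
    KuboFrame (pinnedChain ω₂ lam β γ) T N M
      (fun a b => if a = b then 0 else γ ^ 2 / T ^ 2 *
        ∫ x, gb a x * (kin (N + M) (termSite N M b) x - T) ∂((pinnedChain ω₂ lam β γ).gibbsMeasure (N + M) T))
      (gb 0) (gb 3) := by
  -- terminal sites as `Fin (N + M)`
  have hlt : ∀ a, termSite N M a < N + M := fun a => by
    fin_cases a <;> simp [termSite] <;> omega
  obtain ⟨s, hs⟩ : ∃ s : Fin 4 → Fin (N + M), ∀ a, (s a).val = termSite N M a :=
    ⟨fun a => ⟨termSite N M a, hlt a⟩, fun a => rfl⟩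
  have hs_inj : Function.Injective s := by
    intro a b h
    exact termSite_injective hN hM (by rw [← hs a, ← hs b, h])
  have hkin : ∀ (b : Fin 4) (x : PhaseSpace (N + M)), kin (N + M) (termSite N M b) x = x.2 (s b) ^ 2 := by
    intro b x
    rw [← hs b]
    exact kin_eq_sq (s b).isLt x
  have hW : deviceWeight N M = termWeight s := deviceWeight_eq_termWeight s hs
  -- the four fields are `1`-pairs of `X_H + γ S_B`, `B = termWeight s`
  have hpde' : ∀ a x, 1 * liouvilleOp (pinnedChain ω₂ lam β γ) (N + M) (gb a) x +
      γ * bathOp (N + M) (termWeight s) T (gb a) x = -(x.2 (s a) ^ 2 - T) := by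
    intro a x
    have e := hpde a x
    rw [show deviceGenerator (pinnedChain ω₂ lam β γ) N M (fun _ => T) (gb a) x =
        DeviceLiouville.deviceGenerator (pinnedChain ω₂ lam β γ) N M (fun _ => T) (gb a) x from rfl,
      deviceGenerator_eq, hW, hkin] at e
    rw [one_mul]
    exact e
  -- the three facts about the Kubo pairings, in the line's vocabulary
  have Jsym : ∀ a b : Fin 4,
      ∫ x, gb a x * (kin (N + M) (termSite N M b) x - T) ∂((pinnedChain ω₂ lam β γ).gibbsMeasure (N + M) T) =
        ∫ x, gb b x * (kin (N + M) (termSite N M a) x - T) ∂((pinnedChain ω₂ lam β γ).gibbsMeasure (N + M) T) := by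
    intro a b
    simp only [hkin]
    exact kuboPairing_symm_measure hω hl.le hβ.le hT s 1 hγ hC hL2 hpde' a b
  have Jrow : ∀ a : Fin 4,
      ∑ b, ∫ x, gb a x * (kin (N + M) (termSite N M b) x - T) ∂((pinnedChain ω₂ lam β γ).gibbsMeasure (N + M) T) =
        T ^ 2 / γ := by
    intro a
    simp only [hkin]
    exact kuboPairing_rowsum_measure hω hl.le hβ.le hT s 1 hγ hC hL2 hpde' a
  have Jpsd : ∀ θ : Fin 4 → ℝ,
      ∑ a, ∑ b, θ a * θ b *
          ∫ x, gb a x * (kin (N + M) (termSite N M b) x - T) ∂((pinnedChain ω₂ lam β γ).gibbsMeasure (N + M) T) ≤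
        T ^ 2 / γ * ∑ a, θ a ^ 2 := by
    intro θ
    simp only [hkin]
    exact kuboPairing_psd_measure hω hl.le hβ.le hT s 1 hγ hC hL2 hpde' hs_inj θ
  have hPγ : (pinnedChain ω₂ lam β γ).γ = γ := rfl
  have hκ : γ ^ 2 / T ^ 2 * (T ^ 2 / γ) = γ := by
    field_simp
  have ht0 : termSite N M 0 = 0 := rfl
  have ht3 : termSite N M 3 = N + M - 1 := rfl
  refine ⟨?_, ?_, h0, h3, ?_, ?_, ?_, ?_⟩
  · -- symmetry (Onsager)
    intro a b
    by_cases hab : a = b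
    · subst hab; rfl
    · simp only [if_neg hab, if_neg (Ne.symm hab), Jsym a b]
  · -- non-negative entropy form
    intro θ
    exact dirichletForm_nonneg_of_rowsum (J := fun a b =>
        ∫ x, gb a x * (kin (N + M) (termSite N M b) x - T) ∂((pinnedChain ω₂ lam β γ).gibbsMeasure (N + M) T))
      (by positivity) (fun a b hab => if_neg hab) Jsym Jrow Jpsd θ
  · -- Kubo row of bath 1
    intro b hb
    beta_reduce
    rw [if_neg (Ne.symm hb), hPγ]
  · -- self-conductance of bath 1 = sum rule
    have hr := Jrow 0
    simp only [Fin.sum_univ_four, ht0] at hr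
    simp only [selfLeft, hPγ]
    rw [if_neg (by decide), if_neg (by decide), if_neg (by decide)]
    linear_combination γ ^ 2 / T ^ 2 * hr + hκ
  · -- Kubo row of bath 4
    intro b hb
    beta_reduce
    rw [if_neg (Ne.symm hb), hPγ]
  · -- self-conductance of bath 4 = sum rule
    have hr := Jrow 3
    simp only [Fin.sum_univ_four, ht3] at hr
    simp only [selfRight, hPγ]
    rw [if_neg (by decide), if_neg (by decide), if_neg (by decide), Jsym 0 3, Jsym 1 3, Jsym 2 3]
    linear_combination γ ^ 2 / T ^ 2 * hr + hκ

/-- **The Kubo frame from four terminal forward fields** (registered form): if all four terminal forward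
fields of the equilibrium device exist in the sense of `IsForwardField`, then some matrix `g` completes the
two END fields to a `KuboFrame`. -/
theorem kuboFrame_of_forwardFields :
    ∀ (ω₂ lam β γ T : ℝ), 0 < ω₂ → 0 < lam → 0 < β → 0 < γ → 0 < T →
      ∀ N M : ℕ, 2 ≤ N → 2 ≤ M → ∀ gb : Fin 4 → PhaseSpace (N + M) → ℝ,
        (∀ a : Fin 4, IsForwardField (pinnedChain ω₂ lam β γ) T N M (termSite N M a) (gb a)) →
        ∃ g : Fin 4 → Fin 4 → ℝ, KuboFrame (pinnedChain ω₂ lam β γ) T N M g (gb 0) (gb 3) := by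
  intro ω₂ lam β γ T hω hl hβ hγ hT N M hN hM gb h
  exact ⟨_, kuboFrame_kuboMatrix hω hl hβ hγ hT hN hM gb (fun a => (h a).1) (fun a => (h a).2.1)
    (fun a => (h a).2.2.2.2) (h 0) (h 3)⟩

/-- **Reduction of the registered stub to existence.** `stub_kuboFrame` follows from the existence of the
four terminal forward fields of the equilibrium device (the fixed-`N` input that is NOT in the tree: an
`L²(μ_T)` mean-zero weak solution of `L_dev g = −(p²_s − T)` at each terminal site — quantitative ergodicity
of the four-thermostat network, Cuneo–Eckmann–Hairer–Rey-Bellet 2018 Thm 2.13 (3) — upgraded to a classical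
field by the landed `deviceForwardField_of_weak`, plus `S_K gb ∈ L²(μ_T)` for the two end fields). -/
theorem stub_kuboFrame_of_forwardFields
    (hex : ∀ (ω₂ lam β γ T : ℝ), 0 < ω₂ → 0 < lam → 0 < β → 0 < γ → 0 < T →
      ∀ N M : ℕ, 2 ≤ N → 2 ≤ M → ∀ a : Fin 4, ∃ gb : PhaseSpace (N + M) → ℝ,
        IsForwardField (pinnedChain ω₂ lam β γ) T N M (termSite N M a) gb) :
    ∀ (ω₂ lam β γ T : ℝ), 0 < ω₂ → 0 < lam → 0 < β → 0 < γ → 0 < T →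
      ∀ N M : ℕ, 2 ≤ N → 2 ≤ M →
        ∃ (g : Fin 4 → Fin 4 → ℝ) (gb₁ gb₄ : PhaseSpace (N + M) → ℝ),
          KuboFrame (pinnedChain ω₂ lam β γ) T N M g gb₁ gb₄ := by
  intro ω₂ lam β γ T hω hl hβ hγ hT N M hN hM
  choose gb hgb using hex ω₂ lam β γ T hω hl hβ hγ hT N M hN hM
  obtain ⟨g, hg⟩ := kuboFrame_of_forwardFields ω₂ lam β γ T hω hl hβ hγ hT N M hN hM gb hgb
  exact ⟨g, gb 0, gb 3, hg⟩

end Main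

end Summit.AtomisticToContinuum.FouriersLaw.Cruxes.SuperadditiveResistance.ThermaliseThenCutProbeInsertion

end
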